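import Mathlib
import Summits.CriticalPhenomena.PercolationContinuityZ3.Theorems.PercNearOneGluingNoHeavyLowerTailPocketSizeGluing
import HarnessLib

/-!
# Crux `PercNearOneGluing.NoHeavyLowerTail` (stmt-CriticalPhenomena-4575), line `bhk-superadditivity-thinning` —
# POCKET-DELETION GLUING: a universal, linear, exponent-free gluing inequality

Lead prover-line-stmt-CriticalPhenomena-4575-c5-0, 2026-08-16.  Proves the registered stubs
`pocketDeletionGluing_block` and `pocketDeletionGluing`; lands with `--supports stmt-CriticalPhenomena-4575`.

## The inequality (valid on EVERY finite weighted graph)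

Relay set `A ∋ b`, observer `o ∉ A`, and `F ∌ o` any vertex set disjoint from `A` such that every
positive-weight pair with an endpoint in `R := {o} ∪ F` has its other endpoint in `R ∪ A` (the smallest
such `F` is the `A`-free component of `o`).  Then, with `μ = prodBernoulli w`,

  `μ(o ↔ A) − μ(o ↔ b) ≤ max_{a ∈ A} μ_{G − R}(a ↮ b)`,                                   (`pocketDeletionGluing`)

where `μ_{G − R}` is the law with every pair meeting `R` given weight `0` (written with a slack parameter
`t` bounding the right-hand side).  Compare the route's crux proxy `AdditiveGluing` (KN Conjecture-1
strength): `μ(o ↔ A) − μ(o ↔ b) ≤ max_a μ_G(a ↮ b)` — the present theorem IS additive gluing with the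
relays' unreliability measured AFTER DELETING THE OBSERVER'S RELAY-FREE REGION.  The gap between the two
is exactly "how much the relays depend on `o`'s pocket": `μ_{G−R}(a ↮ b) − μ_G(a ↮ b) = P(a ↔ b only
through R)`.  So Kozma–Nitzan's Conjecture 3 ≡ this crux holds with the LINEAR rate `δ = ε/2` on every
class where the relays' lifelines avoid the pocket (`max_a μ_{G−R}(a ↮ b) ≤ δ`), whatever the size, depth
or number of doors of the pocket; and by the off-set transfer (`offSet_reliability_transfer`)
`bad · μ(R ↮ b) ≤ max_a μ_G(a ↮ b)` always.

It is the exponent-free member of the family proved in `…PocketSizeGluing.lean` / `…PocketDepthGluing.lean`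
(same block σ-recursion, same tools): at every peeling round the sub-instances' relay unreliabilities are
bounded by the deadness with the WHOLE free region deleted (monotone in the deleted set), so nothing is
paid per round and no induction on a rate is needed.

## Proof (block form, strong induction on `|F|`)

For a contracted block `O` (`μ = prodBernoulli (glue w O)`): `bad = Σ_S μ(L_S) · bad'_S` over the values `S`
of the open layer (`blockLayerDecomposition`).  A layer meeting `A` at `v`: `bad'_S ≤ P'_S(v ↮ b) ≤
P_{kill w O}(v ↮ b) ≤ P_{kill w (O ∪ F)}(v ↮ b) ≤ t` (monotone coupling twice).  A non-empty layer avoiding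
`A` lies in `F`, and `(kill w O, S, F ∖ S)` is a smaller instance whose fully-deleted weights
`kill (kill w O) (S ∪ (F ∖ S))` ARE `kill w (O ∪ F)`: by induction `bad'_S ≤ t`.  Hence `bad ≤ t`.  Base
`F = ∅`: `blockStarGluing` (KN Thm 4, block form).  No new definitions
(`kill w X = fun e => if (∃ x ∈ e, x ∈ X) then 0 else w e`).
-/

namespace Summit.CriticalPhenomena.PercolationContinuityZ3.Theorems

open MeasureTheory Set
open Literature.Probability.LatticeModels (prodBernoulli prodBernoulli_real_mono_of_isUpperSet)
open Literature.Probability.Percolation (BondConfig openConn isUpperSet_openConn)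

noncomputable section
open Classical

variable {n : ℕ}

/-! ### Monotonicity tools -/

/-- Deleting more makes relays deader: for `X ⊆ Y`, `P_{kill w X}(a ↮ b) ≤ P_{kill w Y}(a ↮ b)`. -/
theorem pocketDel_kill_mono (w : Sym2 (Fin n) → unitInterval) {X Y : Finset (Fin n)} (hXY : X ⊆ Y)
    (a b : Fin n) :
    (prodBernoulli (fun e : Sym2 (Fin n) => if (∃ x ∈ e, x ∈ X) then 0 else w e)).real (openConn a b)ᶜ ≤
      (prodBernoulli (fun e : Sym2 (Fin n) => if (∃ x ∈ e, x ∈ Y) then 0 else w e)).real (openConn a b)ᶜ := by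
  have hle : (fun e : Sym2 (Fin n) => if (∃ x ∈ e, x ∈ Y) then (0 : unitInterval) else w e) ≤
      (fun e : Sym2 (Fin n) => if (∃ x ∈ e, x ∈ X) then 0 else w e) := by
    intro e
    show (if (∃ x ∈ e, x ∈ Y) then (0 : unitInterval) else w e) ≤ (if (∃ x ∈ e, x ∈ X) then 0 else w e)
    by_cases hY : ∃ x ∈ e, x ∈ Y
    · rw [if_pos hY]
      exact unitInterval.nonneg'
    · have hX : ¬ ∃ x ∈ e, x ∈ X := fun ⟨x, hx, hxX⟩ => hY ⟨x, hx, hXY hxX⟩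
      rw [if_neg hY, if_neg hX]
  have hmono := prodBernoulli_real_mono_of_isUpperSet hle (isUpperSet_openConn a b)
    (pocketGlue_measurableSet _)
  rw [probReal_compl_eq_one_sub (pocketGlue_measurableSet _),
    probReal_compl_eq_one_sub (pocketGlue_measurableSet _)]
  linarith

/-- Contracting a block makes relays more reliable than deleting it:
`P_{glue w O}(a ↮ b) ≤ P_{kill w O}(a ↮ b)`. -/
theorem pocketDel_glue_le_kill (w : Sym2 (Fin n) → unitInterval) (O : Finset (Fin n)) (a b : Fin n) :
    (prodBernoulli (fun e : Sym2 (Fin n) => if (∀ x ∈ e, x ∈ O) ∧ ¬ e.IsDiag then 1 else w e)).real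
        (openConn a b)ᶜ ≤
      (prodBernoulli (fun e : Sym2 (Fin n) => if (∃ x ∈ e, x ∈ O) then 0 else w e)).real (openConn a b)ᶜ := by
  have hle : (fun e : Sym2 (Fin n) => if (∃ x ∈ e, x ∈ O) then (0 : unitInterval) else w e) ≤
      (fun e : Sym2 (Fin n) => if (∀ x ∈ e, x ∈ O) ∧ ¬ e.IsDiag then 1 else w e) := by
    intro e
    show (if (∃ x ∈ e, x ∈ O) then (0 : unitInterval) else w e) ≤
      (if (∀ x ∈ e, x ∈ O) ∧ ¬ e.IsDiag then 1 else w e)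
    by_cases h1 : ∃ x ∈ e, x ∈ O
    · rw [if_pos h1]
      exact unitInterval.nonneg'
    · rw [if_neg h1]
      by_cases h2 : (∀ x ∈ e, x ∈ O) ∧ ¬ e.IsDiag
      · rw [if_pos h2]
        exact unitInterval.le_one'
      · rw [if_neg h2]
  have hmono := prodBernoulli_real_mono_of_isUpperSet hle (isUpperSet_openConn a b)
    (pocketGlue_measurableSet _)
  rw [probReal_compl_eq_one_sub (pocketGlue_measurableSet _),
    probReal_compl_eq_one_sub (pocketGlue_measurableSet _)]
  linarith

/-- Deleting in two rounds is deleting the union: `kill (kill w O) F = kill w (O ∪ F)` as weight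
functions (stated for the literal lambdas). -/
theorem pocketDel_kill_kill (w : Sym2 (Fin n) → unitInterval) (O F : Finset (Fin n)) :
    (fun e : Sym2 (Fin n) => if (∃ x ∈ e, x ∈ F) then 0 else if (∃ x ∈ e, x ∈ O) then 0 else w e) =
      (fun e : Sym2 (Fin n) => if (∃ x ∈ e, x ∈ O ∪ F) then 0 else w e) := by
  funext e
  by_cases hF : ∃ x ∈ e, x ∈ F
  · obtain ⟨x, hx, hxF⟩ := hF
    rw [if_pos ⟨x, hx, hxF⟩, if_pos ⟨x, hx, Finset.mem_union_right O hxF⟩]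
  · rw [if_neg hF]
    by_cases hO : ∃ x ∈ e, x ∈ O
    · obtain ⟨x, hx, hxO⟩ := hO
      rw [if_pos ⟨x, hx, hxO⟩, if_pos ⟨x, hx, Finset.mem_union_left F hxO⟩]
    · have hOF : ¬ ∃ x ∈ e, x ∈ O ∪ F := by
        rintro ⟨x, hx, hxOF⟩
        rcases Finset.mem_union.1 hxOF with h | h
        · exact hO ⟨x, hx, h⟩
        · exact hF ⟨x, hx, h⟩
      rw [if_neg hO, if_neg hOF]

/-! ### The step -/

/-- **Inductive step (deletion form).**  For a contracted block `O` with free region `F` (closed under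
positive-weight non-relay adjacency from `O ∪ F`), if `t` bounds every relay's unreliability with `O ∪ F`
DELETED, and the same inequality is granted for all instances with fewer free vertices, then
`bad ≤ t`. -/
theorem pocketDel_step (w : Sym2 (Fin n) → unitInterval) (O F A : Finset (Fin n)) (b : Fin n) (t : ℝ)
    (hbA : b ∈ A) (hOA : Disjoint O A) (hFA : Disjoint F A)
    (hcl : ∀ x ∈ O ∪ F, ∀ y : Fin n, y ∉ O → y ∉ F → y ∉ A → w s(x, y) = 0)
    (hrel : ∀ a ∈ A, (prodBernoulli (fun e : Sym2 (Fin n) =>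
      if (∃ x ∈ e, x ∈ O ∪ F) then 0 else w e)).real (openConn a b)ᶜ ≤ t)
    (IH : ∀ (w' : Sym2 (Fin n) → unitInterval) (O' F' : Finset (Fin n)) (t' : ℝ), F'.card < F.card →
      Disjoint O' A → Disjoint F' A → Disjoint O' F' →
      (∀ x ∈ O' ∪ F', ∀ y : Fin n, y ∉ O' → y ∉ F' → y ∉ A → w' s(x, y) = 0) →
      (∀ a ∈ A, (prodBernoulli (fun e : Sym2 (Fin n) =>
        if (∃ x ∈ e, x ∈ O' ∪ F') then 0 else w' e)).real (openConn a b)ᶜ ≤ t') →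
      (prodBernoulli (fun e : Sym2 (Fin n) =>
          if (∀ x ∈ e, x ∈ O') ∧ ¬ e.IsDiag then 1 else w' e)).real (⋃ o ∈ O', ⋃ x ∈ A, openConn o x) -
        (prodBernoulli (fun e : Sym2 (Fin n) =>
          if (∀ x ∈ e, x ∈ O') ∧ ¬ e.IsDiag then 1 else w' e)).real (⋃ o ∈ O', openConn o b) ≤ t') :
    (prodBernoulli (fun e : Sym2 (Fin n) => if (∀ x ∈ e, x ∈ O) ∧ ¬ e.IsDiag then 1 else w e)).real
        (⋃ o ∈ O, ⋃ x ∈ A, openConn o x) -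
      (prodBernoulli (fun e : Sym2 (Fin n) => if (∀ x ∈ e, x ∈ O) ∧ ¬ e.IsDiag then 1 else w e)).real
        (⋃ o ∈ O, openConn o b) ≤ t := by
  have hbO : b ∉ O := fun h => Finset.disjoint_left.1 hOA h hbA
  -- `0 ≤ t` (the relay hypothesis at `b`)
  have ht0 : 0 ≤ t := by
    have h := hrel b hbA
    have huniv : (openConn b b : Set (BondConfig (Fin n))) = Set.univ :=
      Set.eq_univ_of_forall fun _ => SimpleGraph.Reachable.refl _
    rw [huniv, Set.compl_univ, measureReal_empty] at h
    exact h
  -- names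
  set g : Sym2 (Fin n) → unitInterval :=
    fun e => if (∀ x ∈ e, x ∈ O) ∧ ¬ e.IsDiag then 1 else w e with hg
  set k : Sym2 (Fin n) → unitInterval := fun e => if (∃ x ∈ e, x ∈ O) then 0 else w e with hk
  set q : Finset (Fin n) → Sym2 (Fin n) → unitInterval := fun S e =>
    if (∀ x ∈ e, x ∈ S) ∧ ¬ e.IsDiag then 1 else if (∃ x ∈ e, x ∈ O) then 0 else w e with hq
  set ℓ : Finset (Fin n) → ℝ := fun S => (prodBernoulli g).real
    {ω : BondConfig (Fin n) | ∀ x : Fin n, x ∈ S ↔ (x ∉ O ∧ ∃ o ∈ O, s(o, x) ∈ ω)} with hℓ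
  set α : Finset (Fin n) → ℝ := fun S => (prodBernoulli (q S)).real
    (⋃ s ∈ S, ⋃ x ∈ A, openConn s x) with hα
  set β : Finset (Fin n) → ℝ := fun S => (prodBernoulli (q S)).real (⋃ s ∈ S, openConn s b) with hβ
  -- the layer decomposition
  obtain ⟨hone, hpos, hAsum, hbsum, -⟩ := blockLayerDecomposition n w O A b b hOA hbO hbO
  change ∑ S : Finset (Fin n), ℓ S = 1 at hone
  change ∀ S : Finset (Fin n), ℓ S ≠ 0 → ∀ x ∈ S, x ∉ O ∧ ∃ o ∈ O, w s(o, x) ≠ 0 at hpos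
  change (prodBernoulli g).real (⋃ o ∈ O, ⋃ x ∈ A, openConn o x) =
    ∑ S : Finset (Fin n), ℓ S * α S at hAsum
  change (prodBernoulli g).real (⋃ o ∈ O, openConn o b) = ∑ S : Finset (Fin n), ℓ S * β S at hbsum
  -- sub-blocks: unreliability at most the fully-deleted deadness, hence at most `t`
  have hsub : ∀ (S : Finset (Fin n)) (a : Fin n), a ∈ A →
      (prodBernoulli (q S)).real (openConn a b)ᶜ ≤ t := by
    intro S a ha
    calc (prodBernoulli (q S)).real (openConn a b)ᶜ ≤ (prodBernoulli k).real (openConn a b)ᶜ :=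
          pocketGlue_compl_mono w O S a b
      _ ≤ (prodBernoulli (fun e : Sym2 (Fin n) => if (∃ x ∈ e, x ∈ O ∪ F) then 0 else w e)).real
            (openConn a b)ᶜ := pocketDel_kill_mono w Finset.subset_union_left a b
      _ ≤ t := hrel a ha
  -- termwise bound `bad'_S ≤ t`
  have hterm : ∀ S : Finset (Fin n), ℓ S ≠ 0 → α S - β S ≤ t := by
    intro S hS0
    have hS := hpos S hS0
    have hα1 : α S ≤ 1 := measureReal_le_one
    by_cases hSA : (S ∩ A).Nonempty
    · obtain ⟨v, hv⟩ := hSA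
      rw [Finset.mem_inter] at hv
      have hvb : 1 - β S ≤ (prodBernoulli (q S)).real (openConn v b)ᶜ := by
        rw [probReal_compl_eq_one_sub (pocketGlue_measurableSet _)]
        have : (prodBernoulli (q S)).real (openConn v b) ≤ β S :=
          measureReal_mono (fun ω hω => Set.mem_iUnion₂.2 ⟨v, hv.1, hω⟩) (measure_ne_top _ _)
        linarith
      linarith [hsub S v hv.2]
    · have hSA' : Disjoint S A :=
        Finset.disjoint_iff_inter_eq_empty.2 (Finset.not_nonempty_iff_eq_empty.1 hSA)
      by_cases hSe : S = ∅
      · subst hSe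
        have hα0 : α ∅ = 0 := by simp [hα]
        have hβ0 : β ∅ = 0 := by simp [hβ]
        rw [hα0, hβ0, sub_zero]
        exact ht0
      · have hSne : S.Nonempty := Finset.nonempty_iff_ne_empty.2 hSe
        have hSF : S ⊆ F := by
          intro x hxS
          obtain ⟨hxO, o, ho, hw⟩ := hS x hxS
          by_contra hxF
          have hxA : x ∉ A := fun h => Finset.disjoint_left.1 hSA' hxS h
          exact hw (hcl o (Finset.mem_union_left F ho) x hxO hxF hxA)
        have hcard : (F \ S).card < F.card := by
          rw [Finset.card_sdiff_of_subset hSF]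
          have : 0 < S.card := Finset.card_pos.2 hSne
          have : S.card ≤ F.card := Finset.card_le_card hSF
          omega
        have hFA' : Disjoint (F \ S) A := Finset.disjoint_of_subset_left Finset.sdiff_subset hFA
        have hSF' : Disjoint S (F \ S) := Finset.disjoint_sdiff
        have hcl' : ∀ x ∈ S ∪ (F \ S), ∀ y : Fin n, y ∉ S → y ∉ F \ S → y ∉ A → k s(x, y) = 0 := by
          intro x hx y hyS hyFS hyA
          simp only [hk]
          split_ifs with hxy
          · rfl
          · push Not at hxy
            have hxO : x ∉ O := fun h => hxy x (Sym2.mem_mk_left x y) h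
            have hyO : y ∉ O := fun h => hxy y (Sym2.mem_mk_right x y) h
            have hxF : x ∈ F := by
              rcases Finset.mem_union.1 hx with h | h
              · exact hSF h
              · exact (Finset.mem_sdiff.1 h).1
            have hyF : y ∉ F := fun h => hyFS (Finset.mem_sdiff.2 ⟨h, hyS⟩)
            exact hcl x (Finset.mem_union_right O hxF) y hyO hyF hyA
        -- the fully-deleted weights of the sub-instance are `kill w (O ∪ F)`
        have hSFu : S ∪ (F \ S) = F := Finset.union_sdiff_of_subset hSF
        have hkk : (fun e : Sym2 (Fin n) => if (∃ x ∈ e, x ∈ S ∪ (F \ S)) then 0 else k e) =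
            (fun e : Sym2 (Fin n) => if (∃ x ∈ e, x ∈ O ∪ F) then 0 else w e) := by
          rw [hSFu, hk]
          exact pocketDel_kill_kill w O F
        have hrel' : ∀ a ∈ A, (prodBernoulli (fun e : Sym2 (Fin n) =>
            if (∃ x ∈ e, x ∈ S ∪ (F \ S)) then 0 else k e)).real (openConn a b)ᶜ ≤ t := by
          intro a ha
          rw [hkk]
          exact hrel a ha
        exact IH k S (F \ S) t hcard hSA' hFA' hSF' hcl' hrel'
  -- sum up
  rw [hAsum, hbsum, ← Finset.sum_sub_distrib]
  have heq : ∑ S : Finset (Fin n), (ℓ S * α S - ℓ S * β S) = ∑ S : Finset (Fin n), ℓ S * (α S - β S) :=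
    Finset.sum_congr rfl fun S _ => by ring
  rw [heq]
  exact pocketGlue_convex_le Finset.univ ℓ (fun S => α S - β S) t (fun S _ => measureReal_nonneg) hone
    fun S _ hS => hterm S hS

/-! ### The registered statements -/

/-- **Pocket-deletion gluing, block form** (registered stub `pocketDeletionGluing_block` of crux
stmt-CriticalPhenomena-4575, line `bhk-superadditivity-thinning`).  For a contracted observer block `O`
(`glue w O`), a relay set `A ∋ b` disjoint from `O`, and a free region `F` (disjoint from `O`, `A`) such that
every positive-weight pair leaving `O ∪ F` ends in `O ∪ F ∪ A`: if every relay has unreliability at most `t`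
in the graph with `O ∪ F` DELETED (`kill w (O ∪ F)`), then `μ(O ↔ A) − μ(O ↔ b) ≤ t`.  Strong induction on
`|F|` (`pocketGlue_base`, `pocketDel_step`). -/
theorem pocketDeletionGluing_block : ∀ (n : ℕ) (w : Sym2 (Fin n) → unitInterval) (O F A : Finset (Fin n)) (b : Fin n) (t : ℝ), b ∈ A → Disjoint O A → Disjoint F A → Disjoint O F → (∀ x ∈ O ∪ F, ∀ y : Fin n, y ∉ O → y ∉ F → y ∉ A → w s(x, y) = 0) → (∀ a ∈ A, (Literature.Probability.LatticeModels.prodBernoulli (fun e : Sym2 (Fin n) => if (∃ x ∈ e, x ∈ O ∪ F) then 0 else w e)).real (Literature.Probability.Percolation.openConn a b)ᶜ ≤ t) → (Literature.Probability.LatticeModels.prodBernoulli (fun e : Sym2 (Fin n) => if (∀ x ∈ e, x ∈ O) ∧ ¬ e.IsDiag then 1 else w e)).real (⋃ o ∈ O, ⋃ x ∈ A, Literature.Probability.Percolation.openConn o x) - (Literature.Probability.LatticeModels.prodBernoulli (fun e : Sym2 (Fin n) => if (∀ x ∈ e, x ∈ O) ∧ ¬ e.IsDiag then 1 else w e)).real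 (⋃ o ∈ O, Literature.Probability.Percolation.openConn o b) ≤ t := by
  intro n w O F A b t hbA hOA hFA hOF hcl hrel
  suffices H : ∀ (m : ℕ) (w : Sym2 (Fin n) → unitInterval) (O F : Finset (Fin n)) (t : ℝ), F.card = m →
      Disjoint O A → Disjoint F A → Disjoint O F →
      (∀ x ∈ O ∪ F, ∀ y : Fin n, y ∉ O → y ∉ F → y ∉ A → w s(x, y) = 0) →
      (∀ a ∈ A, (prodBernoulli (fun e : Sym2 (Fin n) =>
        if (∃ x ∈ e, x ∈ O ∪ F) then 0 else w e)).real (openConn a b)ᶜ ≤ t) →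
      (prodBernoulli (fun e : Sym2 (Fin n) => if (∀ x ∈ e, x ∈ O) ∧ ¬ e.IsDiag then 1 else w e)).real
          (⋃ o ∈ O, ⋃ x ∈ A, openConn o x) -
        (prodBernoulli (fun e : Sym2 (Fin n) => if (∀ x ∈ e, x ∈ O) ∧ ¬ e.IsDiag then 1 else w e)).real
          (⋃ o ∈ O, openConn o b) ≤ t from
    H F.card w O F t rfl hOA hFA hOF hcl hrel
  intro m
  induction m using Nat.strong_induction_on with
  | _ m IHm =>
    intro w O F t hm hOA hFA hOF hcl hrel
    by_cases hF : F = ∅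
    · subst hF
      refine pocketGlue_base w O A b t hbA hOA (fun x hx y hyO hyA => ?_) (fun a ha => ?_)
      · exact hcl x (by simpa using hx) y hyO (Finset.notMem_empty y) hyA
      · have h := hrel a ha
        simp only [Finset.union_empty] at h
        exact le_trans (pocketDel_glue_le_kill w O a b) h
    · exact pocketDel_step w O F A b t hbA hOA hFA hcl hrel
        (fun w' O' F' t' hlt hO'A hF'A hO'F' hcl' hrel' =>
          IHm F'.card (hm ▸ hlt) w' O' F' t' rfl hO'A hF'A hO'F' hcl' hrel')

/-- **Pocket-deletion gluing** (registered stub `pocketDeletionGluing` of crux stmt-CriticalPhenomena-4575,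
line `bhk-superadditivity-thinning`) — valid on EVERY finite weighted graph: relay set `A ∋ b`, observer
`o ∉ A`, and `F ∌ o` disjoint from `A` with every positive-weight pair leaving `{o} ∪ F` ending in
`{o} ∪ F ∪ A` (e.g. `F` = the `A`-free component of `o`).  If `μ_{G − ({o} ∪ F)}(a ↮ b) ≤ t` for all
`a ∈ A` (the law with every pair meeting `{o} ∪ F` given weight `0`) then `μ(o ↔ A) − μ(o ↔ b) ≤ t`:
ADDITIVE GLUING WITH THE RELAYS' UNRELIABILITY MEASURED OFF THE OBSERVER'S POCKET.  The case `O = {o}`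
of `pocketDeletionGluing_block`. -/
theorem pocketDeletionGluing : ∀ (n : ℕ) (w : Sym2 (Fin n) → unitInterval) (F A : Finset (Fin n)) (o b : Fin n) (t : ℝ), b ∈ A → o ∉ A → o ∉ F → Disjoint F A → (∀ x ∈ insert o F, ∀ y : Fin n, y ≠ o → y ∉ F → y ∉ A → w s(x, y) = 0) → (∀ a ∈ A, (Literature.Probability.LatticeModels.prodBernoulli (fun e : Sym2 (Fin n) => if (∃ x ∈ e, x ∈ insert o F) then 0 else w e)).real (Literature.Probability.Percolation.openConn a b)ᶜ ≤ t) → (Literature.Probability.LatticeModels.prodBernoulli w).real (⋃ a ∈ A, Literature.Probability.Percolation.openConn o a) - (Literature.Probability.LatticeModels.prodBernoulli w).real (Literature.Probability.Percolation.openConn o b) ≤ t := by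
  intro n w F A o b t hbA hoA hoF hFA hcl hrel
  have hOA : Disjoint ({o} : Finset (Fin n)) A := Finset.disjoint_singleton_left.2 hoA
  have hOF : Disjoint ({o} : Finset (Fin n)) F := Finset.disjoint_singleton_left.2 hoF
  have hcl' : ∀ x ∈ ({o} : Finset (Fin n)) ∪ F, ∀ y : Fin n,
      y ∉ ({o} : Finset (Fin n)) → y ∉ F → y ∉ A → w s(x, y) = 0 := by
    intro x hx y hyo hyF hyA
    rw [← Finset.insert_eq] at hx
    exact hcl x hx y (fun h => hyo (Finset.mem_singleton.2 h)) hyF hyA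
  have hrel' : ∀ a ∈ A, (prodBernoulli (fun e : Sym2 (Fin n) =>
      if (∃ x ∈ e, x ∈ ({o} : Finset (Fin n)) ∪ F) then 0 else w e)).real (openConn a b)ᶜ ≤ t := by
    rw [← Finset.insert_eq]
    exact hrel
  have key := pocketDeletionGluing_block n w {o} F A b t hbA hOA hFA hOF hcl' hrel'
  rw [agPartial_glue_singleton, Finset.set_biUnion_singleton, Finset.set_biUnion_singleton] at key
  exact key

end

end Summit.CriticalPhenomena.PercolationContinuityZ3.Theorems
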